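import Summits.QuantumFields.BalabanUV.Beta.GAN24.CombExitFaceSlotStaircaseDeep
import Summits.QuantumFields.BalabanUV.Beta.GAN24.FaceWordEEDiagDeep

/-!
# `BalabanUV.Beta.GAN24.CombFaceWordEEValueDeep` — binder row G-an2-4 ∕ (CONV-C), TRANSFER-III, the (III′) (C)-row's `hXF (l+1)` FACE TERMS (OWNER gan24-p1 g53's memo
# `M3-HXF-SIZING-g53.md` §1, «deep face value»): **THE E⊗E DEEP-PERIOD FACE WORD OF THE COMB FORCING IN CELL-PAIRING FORM, VALUED — leaf-06 g56's `FaceWordEEValueDeep` §2–§3 AND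
# g57's `FaceWordEEDiagDeep` §2 WITH THE SPINE E-SECTOR `e3OfK Lc G_j (SrecAt … j)` REPLACED BY THE COMB CUBIC SECTOR `V^c_j = e3OfK Lc G_j (𝒯 S̃comb_j)`** (an1's record
# `symTablesAn1S2 d Lc cΛt`, comb root `toSite (ctrOff (d+1) Lc)`, the Ward pins; every `d j cΛt cΛ`, every `N ≥ 1`, all units): with `M = Lc·N` and the period-`M` two-face currents
# `FF_L(a,x) = Σ'_y χ_M(y_α)·Σ'_t χ_M(t_μ)·V^c_j μ t (y,x)_{αa}`, `FF_R(b,z) = Σ'_w χ_M(w_β)·Σ'_t χ_M(t_ν)·V^c_j ν t (z,w)_{bβ}`,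
# `Σ_{x∈box M} Σ_a FF_L(a,x)·Σ'_z Σ_b X̃_{j+1}(x,z)_{ab}·FF_R(b,z)` EQUALS leaf-06's value `(−½)·½·sf²·(wVH_{j+1}⁻¹·⟨q^{(M)}_{μα}, E2_{j+1} q^{(M)}_{νβ}⟩_{box M} − wVH_{j+1}⁻¹·Lc^{2(d+1)}·⟨q^{(N)}_{μα}, E2_{j+2} q^{(N)}_{νβ}⟩_{box N})`
# (`μ ≠ α`, `ν ≠ β`) and VANISHES on the diagonal patterns — THE SAME RIGHT-HAND SIDES AS THE SPINE's, LETTER FOR LETTER (Engine C E2: F_{3,1} comb == etwin — now by name).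
# (G-an2-4 CRUX TEAM (2), leaf prover `b2b-balaban-gan24-formalise-leaf-01`, gen 88; journal [LEAF01-G88-INTENT-1])

NOT IN PRINT; OUR BOOKKEEPING ([folklore] leaf-06's texts token for token: the member enters ONLY through the two current closed forms, which are my B1
`CombExitFaceSlotStaircaseDeep.faceface_e3OfK_eq_stairN(_fst)` (same right-hand sides as `ExitFaceSlotStaircaseDeep`'s); everything else — K5's bridge
`StepCovarianceCellPairingTent.sum_box_E2T_mul_dressedStep_E2_apply_bridge` at the kernel root `ctrOff (d+1) Lc ∈ box`, `StaircaseCurrentPeriodicDeep.stairFace_eq_periodicM ∕ _fstM ∕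
qProfile_translateM ∕ abs_qProfile_leM`, `FaceWordEEValueDeep.contourSum_qProfile_deep ∕ tsum_sum_mul_const_mul ∕ faceface_unitS_smul'`, `FaceWordEEDiagDeep.stairFace_diag_eq_zeroM ∕ _fstM` —
is member-free and cited BY NAME; 0 `def`, 0 cited fact, 0 `def … : Prop`, 0 sorry).
HONEST FRAMING (cell contract, verbatim): «discharging `BetaPertH` makes Bałaban's UV stability UNCONDITIONAL — a real constructive-QFT result; it is NOT the continuum limit and NOT the
Clay problem.»  HONEST DEPENDENCY (verbatim): «continuum YM on T⁴ ⇐ BetaPertH ∧ nine spine estimates (0/9 proved); BetaPertH ⇐ (D1) ∧ (D4) ∧ CAP+tail; G-an2-4 gates asym, D1 and NE2/3/4.»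

WHAT ([folklore]; `[NeZero Lc]`, `[NeZero N]`, every `d j cΛt cΛ`, all units `sf sm`, amplitude `cE` free in the `_units` forms): §1 **`cellPairing_deep_value`** (raw comb cubic sector),
**`cellPairing_deep_value_units`** (`unitS sf sm (cE • V^c_j)`); §2 `cellPairing_deep_eq_zero_of_right_diag ∕ _left_diag` (raw) and `…_units`.  Same names as leaf-06's, in the namespace
`CombFaceWordEEValueDeep`.  Asserts NO value of Bałaban's tables beyond an1's ∕ an2's DEFINED ones; discharges NOTHING of `hXF (l+1)` by itself (the transport removal
`CombFaceWordCellPairing` and the adapter instance are the sequel); NEVER «G-an2-4 closed» as (CONV-C); NOT D1, NOT `BetaPertH`, NOT continuum, NOT Clay.  2026-08-27; no existing file touched.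
-/

noncomputable section

open Finset
open scoped BigOperators
open Literature.MathematicalPhysics.QuantumFieldTheory
open Literature.MathematicalPhysics.QuantumFieldTheory.Balaban1983to89
open Literature.MathematicalPhysics.QuantumFieldTheory.Balaban1983to89.Beta
open ExpKernelCalculus (Site MKer comp)
open AffineAveraging (box toSite contourSum)
open AveragingContoursRooted (ctr ctrOff ctrOff_mem_box)
open OneStepResolventKernel (Fib)
open OneStepKernelFamily (KInvStep)
open BalabanStepJetsSucc (E2 wVH)
open Summit.QuantumFields.BalabanUV.Beta.TameKernelCalculus (trK)
open Summit.QuantumFields.BalabanUV.Beta.AxialDressingRooted (coDressKBmAt one_le_of_neZero)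
open Summit.QuantumFields.BalabanUV.Beta.HessKerDressedUnits (unitK unitS unitS_apply legScale_inl)
open Summit.QuantumFields.BalabanUV.Beta.SpineRooted (e3OfK)
open Summit.QuantumFields.BalabanUV.Beta.SymSecondOrderTablesAn1 (symTablesAn1S2)
open Summit.QuantumFields.BalabanUV.Beta.CombChartStepJets (ScombOf)
open Summit.QuantumFields.BalabanUV.Beta.SymCorrectorKernel (psiKS)
open Summit.QuantumFields.BalabanUV.Beta.SymCorrectorFace (slotPsiS)
open Summit.QuantumFields.BalabanUV.Beta.GAN24.CombExitFaceSlotStaircaseDeep (faceface_e3OfK_eq_stairN faceface_e3OfK_eq_stairN_fst)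
open Summit.QuantumFields.BalabanUV.Beta.GAN24.StaircaseCurrentPeriodicDeep (stairFace_eq_periodicM stairFace_eq_periodic_fstM qProfile_translateM abs_qProfile_leM)
open Summit.QuantumFields.BalabanUV.Beta.GAN24.StepCovarianceCellPairingTent (sum_box_E2T_mul_dressedStep_E2_apply_bridge)
open Summit.QuantumFields.BalabanUV.Beta.GAN24.FaceWordEEValueDeep (contourSum_qProfile_deep tsum_sum_mul_const_mul faceface_unitS_smul')
open Summit.QuantumFields.BalabanUV.Beta.GAN24.FaceWordEEDiagDeep (stairFace_diag_eq_zeroM stairFace_diag_eq_zero_fstM)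

namespace Summit.QuantumFields.BalabanUV.Beta.GAN24.CombFaceWordEEValueDeep

variable {d : ℕ} {Lc : ℕ} [NeZero Lc]

/-! ## §1 The comb E-sector exchange face word at the deep period, valued (raw table and unit-scaled table) -/

/-- NOT IN PRINT; OUR BOOKKEEPING.  **THE E⊗E FACE WORD OF THE LEVEL-`(j+1)` FORCING AT PERIOD `Lc·N`, IN CELL-PAIRING FORM, VALUED** (`μ ≠ α`, `ν ≠ β`; every `j`,
in-block root, every `d`, `Lc, N ≥ 1`): with `V_j = e3OfK Lc G_j (SrecAt … j)` (E's pins), `X̃♮ = unitK sf sm G_{j+1}`, `M = Lc·N` and the period-`M` two-face currents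
`FF_L(a,x) = Σ'_y χ_M(y_α)·Σ'_t χ_M(t_μ)·V_j μ t (y,x)_{αa}`, `FF_R(b,z) = Σ'_w χ_M(w_β)·Σ'_t χ_M(t_ν)·V_j ν t (z,w)_{bβ}`,
`Σ_{x∈box M} Σ_a FF_L(a,x)·Σ'_z Σ_b X̃♮(x,z)_{ab}·FF_R(b,z) = (−½)·½·sf²·( wVH_{j+1}⁻¹·⟨q^{(M)}_{μα}, E2_{j+1} q^{(M)}_{νβ}⟩_{box M} − wVH_{j+1}⁻¹·Lc^{2(d+1)}·⟨q^{(N)}_{μα}, E2_{j+2} q^{(N)}_{νβ}⟩_{box N} )`. -/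
theorem cellPairing_deep_value (cΛt sf sm cΛ : ℝ) (j N : ℕ) [NeZero N] {μ α ν β : Fin (d + 1)} (hμα : μ ≠ α) (hνβ : ν ≠ β) :
    ∑ x ∈ box (d + 1) (Lc * N), ∑ a : Fin (d + 1),
        (∑' y : Site (d + 1), (if y α % ((Lc * N : ℕ) : ℤ) = ((Lc * N : ℕ) : ℤ) - 1 then (1 : ℝ) else 0) *
          ∑' t : Site (d + 1), (if t μ % ((Lc * N : ℕ) : ℤ) = ((Lc * N : ℕ) : ℤ) - 1 then
            e3OfK Lc (coDressKBmAt (toSite (ctrOff (d + 1) Lc)) Lc (KInvStep (d := d) Lc j))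
              (fun κ u => comp (comp (trK (psiKS (ctrOff (d + 1) Lc) Lc)) (slotPsiS (ctrOff (d + 1) Lc) Lc (ScombOf (symTablesAn1S2 d Lc cΛt) ((Lc : ℝ) ^ (d + 1)) (-((Lc : ℝ) ^ (d + 1) * (1 / 2) * (Lc : ℝ) ^ (d + 1))) cΛ j) κ u)) (psiKS (ctrOff (d + 1) Lc) Lc)) μ t y (toSite x) (Sum.inl α) (Sum.inl a)
            else 0)) *
        (∑' z : Site (d + 1), ∑ b : Fin (d + 1), unitK sf sm (coDressKBmAt (toSite (ctrOff (d + 1) Lc)) Lc (KInvStep (d := d) Lc (j + 1))) (toSite x) z (Sum.inl a) (Sum.inl b) *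
          (∑' w : Site (d + 1), (if w β % ((Lc * N : ℕ) : ℤ) = ((Lc * N : ℕ) : ℤ) - 1 then (1 : ℝ) else 0) *
            ∑' t : Site (d + 1), (if t ν % ((Lc * N : ℕ) : ℤ) = ((Lc * N : ℕ) : ℤ) - 1 then
              e3OfK Lc (coDressKBmAt (toSite (ctrOff (d + 1) Lc)) Lc (KInvStep (d := d) Lc j))
                (fun κ u => comp (comp (trK (psiKS (ctrOff (d + 1) Lc) Lc)) (slotPsiS (ctrOff (d + 1) Lc) Lc (ScombOf (symTablesAn1S2 d Lc cΛt) ((Lc : ℝ) ^ (d + 1)) (-((Lc : ℝ) ^ (d + 1) * (1 / 2) * (Lc : ℝ) ^ (d + 1))) cΛ j) κ u)) (psiKS (ctrOff (d + 1) Lc) Lc)) ν t z w (Sum.inl b) (Sum.inl β)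
              else 0))) =
      (-(1 / 2 : ℝ)) * (1 / 2 : ℝ) * ((sf * sf) *
        ((wVH d Lc (j + 1))⁻¹ *
            ∑ x ∈ box (d + 1) (Lc * N), ∑ b : Fin (d + 1),
              ((if b = μ then ((((Lc * N : ℕ) : ℝ))⁻¹ * (((Lc * N : ℕ) : ℝ))⁻¹) * ((((toSite x α % ((Lc * N : ℕ) : ℤ) : ℤ) : ℝ) - ((((Lc * N : ℕ) : ℝ)) - 1) / 2)) else 0)
                + (if b = α then (-(((Lc * N : ℕ) : ℝ))⁻¹ * ((((toSite x μ % ((Lc * N : ℕ) : ℤ) : ℤ) : ℝ) - ((((Lc * N : ℕ) : ℝ)) - 1) / 2))) *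
                    (if toSite x α % ((Lc * N : ℕ) : ℤ) = ((Lc * N : ℕ) : ℤ) - 1 then (1 : ℝ) else 0) else 0)) *
              ∑' s : Site (d + 1), ∑ b' : Fin (d + 1), E2 d Lc (j + 1) (toSite x) s (Sum.inl b) (Sum.inl b') *
                ((if b' = ν then ((((Lc * N : ℕ) : ℝ))⁻¹ * (((Lc * N : ℕ) : ℝ))⁻¹) * ((((s β % ((Lc * N : ℕ) : ℤ) : ℤ) : ℝ) - ((((Lc * N : ℕ) : ℝ)) - 1) / 2)) else 0)
                  + (if b' = β then (-(((Lc * N : ℕ) : ℝ))⁻¹ * ((((s ν % ((Lc * N : ℕ) : ℤ) : ℤ) : ℝ) - ((((Lc * N : ℕ) : ℝ)) - 1) / 2))) *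
                      (if s β % ((Lc * N : ℕ) : ℤ) = ((Lc * N : ℕ) : ℤ) - 1 then (1 : ℝ) else 0) else 0)) -
          (wVH d Lc (j + 1))⁻¹ * (((Lc : ℝ) ^ (d + 1) * (Lc : ℝ) ^ (d + 1)) *
            ∑ y ∈ box (d + 1) N, ∑ a : Fin (d + 1),
              ((if a = μ then (((N : ℝ))⁻¹ * ((N : ℝ))⁻¹) * ((((toSite y α % (N : ℤ)) : ℤ) : ℝ) - ((N : ℝ) - 1) / 2) else 0)
                + (if a = α then (-((N : ℝ))⁻¹ * ((((toSite y μ % (N : ℤ)) : ℤ) : ℝ) - ((N : ℝ) - 1) / 2)) *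
                    (if toSite y α % (N : ℤ) = (N : ℤ) - 1 then (1 : ℝ) else 0) else 0)) *
              ∑' s : Site (d + 1), ∑ b' : Fin (d + 1), E2 d Lc (j + 2) (toSite y) s (Sum.inl a) (Sum.inl b') *
                ((if b' = ν then (((N : ℝ))⁻¹ * ((N : ℝ))⁻¹) * ((((s β % (N : ℤ)) : ℤ) : ℝ) - ((N : ℝ) - 1) / 2) else 0)
                  + (if b' = β then (-((N : ℝ))⁻¹ * ((((s ν % (N : ℤ)) : ℤ) : ℝ) - ((N : ℝ) - 1) / 2)) *
                      (if s β % (N : ℤ) = (N : ℤ) - 1 then (1 : ℝ) else 0) else 0))))) := by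
  have hLc : 1 ≤ Lc := one_le_of_neZero Lc
  have hN : 1 ≤ N := one_le_of_neZero N
  have hM : 1 ≤ Lc * N := Nat.mul_pos hLc hN
  -- K5's bridge on the two period-`(Lc·N)` pre-images, with K3's proportional block contour sums
  have hval := sum_box_E2T_mul_dressedStep_E2_apply_bridge (ctrOff_mem_box (Nat.pos_of_ne_zero (NeZero.ne Lc))) sf sm j N ((Lc : ℝ) ^ (d + 1))
    (qL := fun b (y : Site (d + 1)) =>
      (if b = μ then ((((Lc * N : ℕ) : ℝ))⁻¹ * (((Lc * N : ℕ) : ℝ))⁻¹) * ((((y α % ((Lc * N : ℕ) : ℤ) : ℤ) : ℝ) - ((((Lc * N : ℕ) : ℝ)) - 1) / 2)) else 0)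
        + (if b = α then (-(((Lc * N : ℕ) : ℝ))⁻¹ * ((((y μ % ((Lc * N : ℕ) : ℤ) : ℤ) : ℝ) - ((((Lc * N : ℕ) : ℝ)) - 1) / 2))) *
            (if y α % ((Lc * N : ℕ) : ℤ) = ((Lc * N : ℕ) : ℤ) - 1 then (1 : ℝ) else 0) else 0))
    (qR := fun b' (s : Site (d + 1)) =>
      (if b' = ν then ((((Lc * N : ℕ) : ℝ))⁻¹ * (((Lc * N : ℕ) : ℝ))⁻¹) * ((((s β % ((Lc * N : ℕ) : ℤ) : ℤ) : ℝ) - ((((Lc * N : ℕ) : ℝ)) - 1) / 2)) else 0)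
        + (if b' = β then (-(((Lc * N : ℕ) : ℝ))⁻¹ * ((((s ν % ((Lc * N : ℕ) : ℤ) : ℤ) : ℝ) - ((((Lc * N : ℕ) : ℝ)) - 1) / 2))) *
            (if s β % ((Lc * N : ℕ) : ℤ) = ((Lc * N : ℕ) : ℤ) - 1 then (1 : ℝ) else 0) else 0))
    (QL := fun a (y : Site (d + 1)) =>
      (if a = μ then (((N : ℝ))⁻¹ * ((N : ℝ))⁻¹) * ((((y α % (N : ℤ)) : ℤ) : ℝ) - ((N : ℝ) - 1) / 2) else 0)
        + (if a = α then (-((N : ℝ))⁻¹ * ((((y μ % (N : ℤ)) : ℤ) : ℝ) - ((N : ℝ) - 1) / 2)) *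
            (if y α % (N : ℤ) = (N : ℤ) - 1 then (1 : ℝ) else 0) else 0))
    (QR := fun b' (s : Site (d + 1)) =>
      (if b' = ν then (((N : ℝ))⁻¹ * ((N : ℝ))⁻¹) * ((((s β % (N : ℤ)) : ℤ) : ℝ) - ((N : ℝ) - 1) / 2) else 0)
        + (if b' = β then (-((N : ℝ))⁻¹ * ((((s ν % (N : ℤ)) : ℤ) : ℝ) - ((N : ℝ) - 1) / 2)) *
            (if s β % (N : ℤ) = (N : ℤ) - 1 then (1 : ℝ) else 0) else 0))
    (fun b y t => qProfile_translateM (d := d) (M := Lc * N) μ α b y t) (fun b' s t => qProfile_translateM (d := d) (M := Lc * N) ν β b' s t)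
    (fun b y => abs_qProfile_leM (d := d) hM μ α b y) (fun b' s => abs_qProfile_leM (d := d) hM ν β b' s)
    (fun κ y => contourSum_qProfile_deep (Lc := Lc) hN hμα κ y) (fun κ y => contourSum_qProfile_deep (Lc := Lc) hN hνβ κ y)
  rw [← hval, Finset.mul_sum]
  refine Finset.sum_congr rfl fun x _ => ?_
  rw [Finset.mul_sum]
  refine Finset.sum_congr rfl fun a _ => ?_
  -- left current: K1b (first-leg form) then K2 (first-leg pre-image)
  rw [faceface_e3OfK_eq_stairN_fst cΛt cΛ j hM hM μ α (toSite x) a, stairFace_eq_periodic_fstM (Lc := Lc) hM j hμα (toSite x) a]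
  -- right current: pointwise in `(z, b)`, K1b then K2
  have hR : ∀ (z : Site (d + 1)) (b : Fin (d + 1)),
      (∑' w : Site (d + 1), (if w β % ((Lc * N : ℕ) : ℤ) = ((Lc * N : ℕ) : ℤ) - 1 then (1 : ℝ) else 0) *
        ∑' t : Site (d + 1), (if t ν % ((Lc * N : ℕ) : ℤ) = ((Lc * N : ℕ) : ℤ) - 1 then
          e3OfK Lc (coDressKBmAt (toSite (ctrOff (d + 1) Lc)) Lc (KInvStep (d := d) Lc j))
            (fun κ u => comp (comp (trK (psiKS (ctrOff (d + 1) Lc) Lc)) (slotPsiS (ctrOff (d + 1) Lc) Lc (ScombOf (symTablesAn1S2 d Lc cΛt) ((Lc : ℝ) ^ (d + 1)) (-((Lc : ℝ) ^ (d + 1) * (1 / 2) * (Lc : ℝ) ^ (d + 1))) cΛ j) κ u)) (psiKS (ctrOff (d + 1) Lc) Lc)) ν t z w (Sum.inl b) (Sum.inl β)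
          else 0)) =
      (1 / 2 : ℝ) * ∑' s : Site (d + 1), ∑ b' : Fin (d + 1), E2 d Lc (j + 1) z s (Sum.inl b) (Sum.inl b') *
        ((if b' = ν then ((((Lc * N : ℕ) : ℝ))⁻¹ * (((Lc * N : ℕ) : ℝ))⁻¹) * ((((s β % ((Lc * N : ℕ) : ℤ) : ℤ) : ℝ) - ((((Lc * N : ℕ) : ℝ)) - 1) / 2)) else 0)
          + (if b' = β then (-(((Lc * N : ℕ) : ℝ))⁻¹ * ((((s ν % ((Lc * N : ℕ) : ℤ) : ℤ) : ℝ) - ((((Lc * N : ℕ) : ℝ)) - 1) / 2))) *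
            (if s β % ((Lc * N : ℕ) : ℤ) = ((Lc * N : ℕ) : ℤ) - 1 then (1 : ℝ) else 0) else 0)) := by
    intro z b
    rw [faceface_e3OfK_eq_stairN cΛt cΛ j hM hM ν β z b, stairFace_eq_periodicM (Lc := Lc) hM j hνβ z b]
  simp_rw [hR]
  rw [tsum_sum_mul_const_mul]
  ring

/-! ## §3 The same for the unit-scaled sector table `unitS sf sm (cE • V_j)` -/

/-- NOT IN PRINT; OUR BOOKKEEPING.  **THE SAME VALUE FOR road-P2's UNIT-SCALED E-SECTOR TABLE `S^E = unitS sf sm (cE • V_j)`** (`μ ≠ α`, `ν ≠ β`): the two currents each carry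
the factor `K_E = (sf·sm)⁻¹·sf⁻²·cE`, so the cell pairing of §2 with `S^E` in place of `V_j` equals `K_E²` times §2's value. -/
theorem cellPairing_deep_value_units (cΛt sf sm cE cΛ : ℝ) (j N : ℕ) [NeZero N] {μ α ν β : Fin (d + 1)} (hμα : μ ≠ α) (hνβ : ν ≠ β) :
    ∑ x ∈ box (d + 1) (Lc * N), ∑ a : Fin (d + 1),
        (∑' y : Site (d + 1), (if y α % ((Lc * N : ℕ) : ℤ) = ((Lc * N : ℕ) : ℤ) - 1 then (1 : ℝ) else 0) *
          ∑' t : Site (d + 1), (if t μ % ((Lc * N : ℕ) : ℤ) = ((Lc * N : ℕ) : ℤ) - 1 then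
            unitS sf sm (fun κ u => cE • e3OfK Lc (coDressKBmAt (toSite (ctrOff (d + 1) Lc)) Lc (KInvStep (d := d) Lc j))
              (fun κ u => comp (comp (trK (psiKS (ctrOff (d + 1) Lc) Lc)) (slotPsiS (ctrOff (d + 1) Lc) Lc (ScombOf (symTablesAn1S2 d Lc cΛt) ((Lc : ℝ) ^ (d + 1)) (-((Lc : ℝ) ^ (d + 1) * (1 / 2) * (Lc : ℝ) ^ (d + 1))) cΛ j) κ u)) (psiKS (ctrOff (d + 1) Lc) Lc)) κ u) μ t y (toSite x) (Sum.inl α) (Sum.inl a)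
            else 0)) *
        (∑' z : Site (d + 1), ∑ b : Fin (d + 1), unitK sf sm (coDressKBmAt (toSite (ctrOff (d + 1) Lc)) Lc (KInvStep (d := d) Lc (j + 1))) (toSite x) z (Sum.inl a) (Sum.inl b) *
          (∑' w : Site (d + 1), (if w β % ((Lc * N : ℕ) : ℤ) = ((Lc * N : ℕ) : ℤ) - 1 then (1 : ℝ) else 0) *
            ∑' t : Site (d + 1), (if t ν % ((Lc * N : ℕ) : ℤ) = ((Lc * N : ℕ) : ℤ) - 1 then
              unitS sf sm (fun κ u => cE • e3OfK Lc (coDressKBmAt (toSite (ctrOff (d + 1) Lc)) Lc (KInvStep (d := d) Lc j))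
                (fun κ u => comp (comp (trK (psiKS (ctrOff (d + 1) Lc) Lc)) (slotPsiS (ctrOff (d + 1) Lc) Lc (ScombOf (symTablesAn1S2 d Lc cΛt) ((Lc : ℝ) ^ (d + 1)) (-((Lc : ℝ) ^ (d + 1) * (1 / 2) * (Lc : ℝ) ^ (d + 1))) cΛ j) κ u)) (psiKS (ctrOff (d + 1) Lc) Lc)) κ u) ν t z w (Sum.inl b) (Sum.inl β)
              else 0))) =
      (((sf * sm)⁻¹ * (sf⁻¹ * sf⁻¹) * cE) * ((sf * sm)⁻¹ * (sf⁻¹ * sf⁻¹) * cE)) *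
      ((-(1 / 2 : ℝ)) * (1 / 2 : ℝ) * ((sf * sf) *
        ((wVH d Lc (j + 1))⁻¹ *
            ∑ x ∈ box (d + 1) (Lc * N), ∑ b : Fin (d + 1),
              ((if b = μ then ((((Lc * N : ℕ) : ℝ))⁻¹ * (((Lc * N : ℕ) : ℝ))⁻¹) * ((((toSite x α % ((Lc * N : ℕ) : ℤ) : ℤ) : ℝ) - ((((Lc * N : ℕ) : ℝ)) - 1) / 2)) else 0)
                + (if b = α then (-(((Lc * N : ℕ) : ℝ))⁻¹ * ((((toSite x μ % ((Lc * N : ℕ) : ℤ) : ℤ) : ℝ) - ((((Lc * N : ℕ) : ℝ)) - 1) / 2))) *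
                    (if toSite x α % ((Lc * N : ℕ) : ℤ) = ((Lc * N : ℕ) : ℤ) - 1 then (1 : ℝ) else 0) else 0)) *
              ∑' s : Site (d + 1), ∑ b' : Fin (d + 1), E2 d Lc (j + 1) (toSite x) s (Sum.inl b) (Sum.inl b') *
                ((if b' = ν then ((((Lc * N : ℕ) : ℝ))⁻¹ * (((Lc * N : ℕ) : ℝ))⁻¹) * ((((s β % ((Lc * N : ℕ) : ℤ) : ℤ) : ℝ) - ((((Lc * N : ℕ) : ℝ)) - 1) / 2)) else 0)
                  + (if b' = β then (-(((Lc * N : ℕ) : ℝ))⁻¹ * ((((s ν % ((Lc * N : ℕ) : ℤ) : ℤ) : ℝ) - ((((Lc * N : ℕ) : ℝ)) - 1) / 2))) *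
                      (if s β % ((Lc * N : ℕ) : ℤ) = ((Lc * N : ℕ) : ℤ) - 1 then (1 : ℝ) else 0) else 0)) -
          (wVH d Lc (j + 1))⁻¹ * (((Lc : ℝ) ^ (d + 1) * (Lc : ℝ) ^ (d + 1)) *
            ∑ y ∈ box (d + 1) N, ∑ a : Fin (d + 1),
              ((if a = μ then (((N : ℝ))⁻¹ * ((N : ℝ))⁻¹) * ((((toSite y α % (N : ℤ)) : ℤ) : ℝ) - ((N : ℝ) - 1) / 2) else 0)
                + (if a = α then (-((N : ℝ))⁻¹ * ((((toSite y μ % (N : ℤ)) : ℤ) : ℝ) - ((N : ℝ) - 1) / 2)) *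
                    (if toSite y α % (N : ℤ) = (N : ℤ) - 1 then (1 : ℝ) else 0) else 0)) *
              ∑' s : Site (d + 1), ∑ b' : Fin (d + 1), E2 d Lc (j + 2) (toSite y) s (Sum.inl a) (Sum.inl b') *
                ((if b' = ν then (((N : ℝ))⁻¹ * ((N : ℝ))⁻¹) * ((((s β % (N : ℤ)) : ℤ) : ℝ) - ((N : ℝ) - 1) / 2) else 0)
                  + (if b' = β then (-((N : ℝ))⁻¹ * ((((s ν % (N : ℤ)) : ℤ) : ℝ) - ((N : ℝ) - 1) / 2)) *
                      (if s β % (N : ℤ) = (N : ℤ) - 1 then (1 : ℝ) else 0) else 0)))))) := by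
  rw [← cellPairing_deep_value cΛt sf sm cΛ j N hμα hνβ, Finset.mul_sum]
  refine Finset.sum_congr rfl fun x _ => ?_
  rw [Finset.mul_sum]
  refine Finset.sum_congr rfl fun a _ => ?_
  -- units out of the left current
  rw [faceface_unitS_smul' sf sm cE _ μ (fun t : Site (d + 1) => t μ % ((Lc * N : ℕ) : ℤ) = ((Lc * N : ℕ) : ℤ) - 1)
      (fun y : Site (d + 1) => (if y α % ((Lc * N : ℕ) : ℤ) = ((Lc * N : ℕ) : ℤ) - 1 then (1 : ℝ) else 0)) (fun y => y) (fun _ => toSite x) α a]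
  -- units out of the right current, pointwise in `(z, b)`
  have hR : ∀ (z : Site (d + 1)) (b : Fin (d + 1)),
      (∑' w : Site (d + 1), (if w β % ((Lc * N : ℕ) : ℤ) = ((Lc * N : ℕ) : ℤ) - 1 then (1 : ℝ) else 0) *
        ∑' t : Site (d + 1), (if t ν % ((Lc * N : ℕ) : ℤ) = ((Lc * N : ℕ) : ℤ) - 1 then
          unitS sf sm (fun κ u => cE • e3OfK Lc (coDressKBmAt (toSite (ctrOff (d + 1) Lc)) Lc (KInvStep (d := d) Lc j))
            (fun κ u => comp (comp (trK (psiKS (ctrOff (d + 1) Lc) Lc)) (slotPsiS (ctrOff (d + 1) Lc) Lc (ScombOf (symTablesAn1S2 d Lc cΛt) ((Lc : ℝ) ^ (d + 1)) (-((Lc : ℝ) ^ (d + 1) * (1 / 2) * (Lc : ℝ) ^ (d + 1))) cΛ j) κ u)) (psiKS (ctrOff (d + 1) Lc) Lc)) κ u) ν t z w (Sum.inl b) (Sum.inl β)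
          else 0)) =
      ((sf * sm)⁻¹ * (sf⁻¹ * sf⁻¹) * cE) *
        (∑' w : Site (d + 1), (if w β % ((Lc * N : ℕ) : ℤ) = ((Lc * N : ℕ) : ℤ) - 1 then (1 : ℝ) else 0) *
          ∑' t : Site (d + 1), (if t ν % ((Lc * N : ℕ) : ℤ) = ((Lc * N : ℕ) : ℤ) - 1 then
            e3OfK Lc (coDressKBmAt (toSite (ctrOff (d + 1) Lc)) Lc (KInvStep (d := d) Lc j))
              (fun κ u => comp (comp (trK (psiKS (ctrOff (d + 1) Lc) Lc)) (slotPsiS (ctrOff (d + 1) Lc) Lc (ScombOf (symTablesAn1S2 d Lc cΛt) ((Lc : ℝ) ^ (d + 1)) (-((Lc : ℝ) ^ (d + 1) * (1 / 2) * (Lc : ℝ) ^ (d + 1))) cΛ j) κ u)) (psiKS (ctrOff (d + 1) Lc) Lc)) ν t z w (Sum.inl b) (Sum.inl β)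
            else 0)) :=
    fun z b => faceface_unitS_smul' sf sm cE _ ν (fun t : Site (d + 1) => t ν % ((Lc * N : ℕ) : ℤ) = ((Lc * N : ℕ) : ℤ) - 1)
      (fun w : Site (d + 1) => (if w β % ((Lc * N : ℕ) : ℤ) = ((Lc * N : ℕ) : ℤ) - 1 then (1 : ℝ) else 0)) (fun _ => z) (fun w => w) b β
  simp_rw [hR]
  rw [tsum_sum_mul_const_mul]
  ring

/-! ## §2 The comb E⊗E face word at the deep period vanishes on the diagonal patterns -/

/-- NOT IN PRINT; OUR BOOKKEEPING.  **RIGHT DIAGONAL (`β = ν`): the cell pairing of `FaceWordEEValueDeep.cellPairing_deep_value` is `0`** — the right two-face current is the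
diagonal staircase current (K1b), which vanishes (§1). -/
theorem cellPairing_deep_eq_zero_of_right_diag (cΛt sf sm cΛ : ℝ) (j N : ℕ) [NeZero N] (μ α ν : Fin (d + 1)) :
    ∑ x ∈ box (d + 1) (Lc * N), ∑ a : Fin (d + 1),
        (∑' y : Site (d + 1), (if y α % ((Lc * N : ℕ) : ℤ) = ((Lc * N : ℕ) : ℤ) - 1 then (1 : ℝ) else 0) *
          ∑' t : Site (d + 1), (if t μ % ((Lc * N : ℕ) : ℤ) = ((Lc * N : ℕ) : ℤ) - 1 then
            e3OfK Lc (coDressKBmAt (toSite (ctrOff (d + 1) Lc)) Lc (KInvStep (d := d) Lc j))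
              (fun κ u => comp (comp (trK (psiKS (ctrOff (d + 1) Lc) Lc)) (slotPsiS (ctrOff (d + 1) Lc) Lc (ScombOf (symTablesAn1S2 d Lc cΛt) ((Lc : ℝ) ^ (d + 1)) (-((Lc : ℝ) ^ (d + 1) * (1 / 2) * (Lc : ℝ) ^ (d + 1))) cΛ j) κ u)) (psiKS (ctrOff (d + 1) Lc) Lc)) μ t y (toSite x) (Sum.inl α) (Sum.inl a)
            else 0)) *
        (∑' z : Site (d + 1), ∑ b : Fin (d + 1), unitK sf sm (coDressKBmAt (toSite (ctrOff (d + 1) Lc)) Lc (KInvStep (d := d) Lc (j + 1))) (toSite x) z (Sum.inl a) (Sum.inl b) *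
          (∑' w : Site (d + 1), (if w ν % ((Lc * N : ℕ) : ℤ) = ((Lc * N : ℕ) : ℤ) - 1 then (1 : ℝ) else 0) *
            ∑' t : Site (d + 1), (if t ν % ((Lc * N : ℕ) : ℤ) = ((Lc * N : ℕ) : ℤ) - 1 then
              e3OfK Lc (coDressKBmAt (toSite (ctrOff (d + 1) Lc)) Lc (KInvStep (d := d) Lc j))
                (fun κ u => comp (comp (trK (psiKS (ctrOff (d + 1) Lc) Lc)) (slotPsiS (ctrOff (d + 1) Lc) Lc (ScombOf (symTablesAn1S2 d Lc cΛt) ((Lc : ℝ) ^ (d + 1)) (-((Lc : ℝ) ^ (d + 1) * (1 / 2) * (Lc : ℝ) ^ (d + 1))) cΛ j) κ u)) (psiKS (ctrOff (d + 1) Lc) Lc)) ν t z w (Sum.inl b) (Sum.inl ν)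
              else 0))) = 0 := by
  have hM : 1 ≤ Lc * N := Nat.mul_pos (one_le_of_neZero Lc) (one_le_of_neZero N)
  refine Finset.sum_eq_zero fun x _ => Finset.sum_eq_zero fun a _ => ?_
  have hR : ∀ (z : Site (d + 1)) (b : Fin (d + 1)),
      (∑' w : Site (d + 1), (if w ν % ((Lc * N : ℕ) : ℤ) = ((Lc * N : ℕ) : ℤ) - 1 then (1 : ℝ) else 0) *
        ∑' t : Site (d + 1), (if t ν % ((Lc * N : ℕ) : ℤ) = ((Lc * N : ℕ) : ℤ) - 1 then
          e3OfK Lc (coDressKBmAt (toSite (ctrOff (d + 1) Lc)) Lc (KInvStep (d := d) Lc j))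
            (fun κ u => comp (comp (trK (psiKS (ctrOff (d + 1) Lc) Lc)) (slotPsiS (ctrOff (d + 1) Lc) Lc (ScombOf (symTablesAn1S2 d Lc cΛt) ((Lc : ℝ) ^ (d + 1)) (-((Lc : ℝ) ^ (d + 1) * (1 / 2) * (Lc : ℝ) ^ (d + 1))) cΛ j) κ u)) (psiKS (ctrOff (d + 1) Lc) Lc)) ν t z w (Sum.inl b) (Sum.inl ν)
          else 0)) = 0 := by
    intro z b
    rw [faceface_e3OfK_eq_stairN cΛt cΛ j hM hM ν ν z b, stairFace_diag_eq_zeroM (Lc := Lc) hM j ν z b, mul_zero]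
  simp_rw [hR, mul_zero, Finset.sum_const_zero, tsum_zero, mul_zero]

/-- NOT IN PRINT; OUR BOOKKEEPING.  **LEFT DIAGONAL (`α = μ`): the cell pairing is `0`** — the left two-face current is the diagonal first-leg staircase current (K1b), which vanishes (§1). -/
theorem cellPairing_deep_eq_zero_of_left_diag (cΛt sf sm cΛ : ℝ) (j N : ℕ) [NeZero N] (μ ν β : Fin (d + 1)) :
    ∑ x ∈ box (d + 1) (Lc * N), ∑ a : Fin (d + 1),
        (∑' y : Site (d + 1), (if y μ % ((Lc * N : ℕ) : ℤ) = ((Lc * N : ℕ) : ℤ) - 1 then (1 : ℝ) else 0) *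
          ∑' t : Site (d + 1), (if t μ % ((Lc * N : ℕ) : ℤ) = ((Lc * N : ℕ) : ℤ) - 1 then
            e3OfK Lc (coDressKBmAt (toSite (ctrOff (d + 1) Lc)) Lc (KInvStep (d := d) Lc j))
              (fun κ u => comp (comp (trK (psiKS (ctrOff (d + 1) Lc) Lc)) (slotPsiS (ctrOff (d + 1) Lc) Lc (ScombOf (symTablesAn1S2 d Lc cΛt) ((Lc : ℝ) ^ (d + 1)) (-((Lc : ℝ) ^ (d + 1) * (1 / 2) * (Lc : ℝ) ^ (d + 1))) cΛ j) κ u)) (psiKS (ctrOff (d + 1) Lc) Lc)) μ t y (toSite x) (Sum.inl μ) (Sum.inl a)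
            else 0)) *
        (∑' z : Site (d + 1), ∑ b : Fin (d + 1), unitK sf sm (coDressKBmAt (toSite (ctrOff (d + 1) Lc)) Lc (KInvStep (d := d) Lc (j + 1))) (toSite x) z (Sum.inl a) (Sum.inl b) *
          (∑' w : Site (d + 1), (if w β % ((Lc * N : ℕ) : ℤ) = ((Lc * N : ℕ) : ℤ) - 1 then (1 : ℝ) else 0) *
            ∑' t : Site (d + 1), (if t ν % ((Lc * N : ℕ) : ℤ) = ((Lc * N : ℕ) : ℤ) - 1 then
              e3OfK Lc (coDressKBmAt (toSite (ctrOff (d + 1) Lc)) Lc (KInvStep (d := d) Lc j))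
                (fun κ u => comp (comp (trK (psiKS (ctrOff (d + 1) Lc) Lc)) (slotPsiS (ctrOff (d + 1) Lc) Lc (ScombOf (symTablesAn1S2 d Lc cΛt) ((Lc : ℝ) ^ (d + 1)) (-((Lc : ℝ) ^ (d + 1) * (1 / 2) * (Lc : ℝ) ^ (d + 1))) cΛ j) κ u)) (psiKS (ctrOff (d + 1) Lc) Lc)) ν t z w (Sum.inl b) (Sum.inl β)
              else 0))) = 0 := by
  have hM : 1 ≤ Lc * N := Nat.mul_pos (one_le_of_neZero Lc) (one_le_of_neZero N)
  refine Finset.sum_eq_zero fun x _ => Finset.sum_eq_zero fun a _ => ?_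
  rw [faceface_e3OfK_eq_stairN_fst cΛt cΛ j hM hM μ μ (toSite x) a, stairFace_diag_eq_zero_fstM (Lc := Lc) hM j μ (toSite x) a, mul_zero, zero_mul]

/-- NOT IN PRINT; OUR BOOKKEEPING.  **RIGHT DIAGONAL, unit-scaled table** `unitS sf sm (cE • V_j)`: the cell pairing is `0`. -/
theorem cellPairing_deep_eq_zero_of_right_diag_units (cΛt sf sm cE cΛ : ℝ) (j N : ℕ) [NeZero N] (μ α ν : Fin (d + 1)) :
    ∑ x ∈ box (d + 1) (Lc * N), ∑ a : Fin (d + 1),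
        (∑' y : Site (d + 1), (if y α % ((Lc * N : ℕ) : ℤ) = ((Lc * N : ℕ) : ℤ) - 1 then (1 : ℝ) else 0) *
          ∑' t : Site (d + 1), (if t μ % ((Lc * N : ℕ) : ℤ) = ((Lc * N : ℕ) : ℤ) - 1 then
            unitS sf sm (fun κ u => cE • e3OfK Lc (coDressKBmAt (toSite (ctrOff (d + 1) Lc)) Lc (KInvStep (d := d) Lc j))
              (fun κ u => comp (comp (trK (psiKS (ctrOff (d + 1) Lc) Lc)) (slotPsiS (ctrOff (d + 1) Lc) Lc (ScombOf (symTablesAn1S2 d Lc cΛt) ((Lc : ℝ) ^ (d + 1)) (-((Lc : ℝ) ^ (d + 1) * (1 / 2) * (Lc : ℝ) ^ (d + 1))) cΛ j) κ u)) (psiKS (ctrOff (d + 1) Lc) Lc)) κ u) μ t y (toSite x) (Sum.inl α) (Sum.inl a)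
            else 0)) *
        (∑' z : Site (d + 1), ∑ b : Fin (d + 1), unitK sf sm (coDressKBmAt (toSite (ctrOff (d + 1) Lc)) Lc (KInvStep (d := d) Lc (j + 1))) (toSite x) z (Sum.inl a) (Sum.inl b) *
          (∑' w : Site (d + 1), (if w ν % ((Lc * N : ℕ) : ℤ) = ((Lc * N : ℕ) : ℤ) - 1 then (1 : ℝ) else 0) *
            ∑' t : Site (d + 1), (if t ν % ((Lc * N : ℕ) : ℤ) = ((Lc * N : ℕ) : ℤ) - 1 then
              unitS sf sm (fun κ u => cE • e3OfK Lc (coDressKBmAt (toSite (ctrOff (d + 1) Lc)) Lc (KInvStep (d := d) Lc j))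
                (fun κ u => comp (comp (trK (psiKS (ctrOff (d + 1) Lc) Lc)) (slotPsiS (ctrOff (d + 1) Lc) Lc (ScombOf (symTablesAn1S2 d Lc cΛt) ((Lc : ℝ) ^ (d + 1)) (-((Lc : ℝ) ^ (d + 1) * (1 / 2) * (Lc : ℝ) ^ (d + 1))) cΛ j) κ u)) (psiKS (ctrOff (d + 1) Lc) Lc)) κ u) ν t z w (Sum.inl b) (Sum.inl ν)
              else 0))) = 0 := by
  have hM : 1 ≤ Lc * N := Nat.mul_pos (one_le_of_neZero Lc) (one_le_of_neZero N)
  refine Finset.sum_eq_zero fun x _ => Finset.sum_eq_zero fun a _ => ?_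
  have hR : ∀ (z : Site (d + 1)) (b : Fin (d + 1)),
      (∑' w : Site (d + 1), (if w ν % ((Lc * N : ℕ) : ℤ) = ((Lc * N : ℕ) : ℤ) - 1 then (1 : ℝ) else 0) *
        ∑' t : Site (d + 1), (if t ν % ((Lc * N : ℕ) : ℤ) = ((Lc * N : ℕ) : ℤ) - 1 then
          unitS sf sm (fun κ u => cE • e3OfK Lc (coDressKBmAt (toSite (ctrOff (d + 1) Lc)) Lc (KInvStep (d := d) Lc j))
            (fun κ u => comp (comp (trK (psiKS (ctrOff (d + 1) Lc) Lc)) (slotPsiS (ctrOff (d + 1) Lc) Lc (ScombOf (symTablesAn1S2 d Lc cΛt) ((Lc : ℝ) ^ (d + 1)) (-((Lc : ℝ) ^ (d + 1) * (1 / 2) * (Lc : ℝ) ^ (d + 1))) cΛ j) κ u)) (psiKS (ctrOff (d + 1) Lc) Lc)) κ u) ν t z w (Sum.inl b) (Sum.inl ν)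
          else 0)) = 0 := by
    intro z b
    rw [faceface_unitS_smul' sf sm cE _ ν (fun t : Site (d + 1) => t ν % ((Lc * N : ℕ) : ℤ) = ((Lc * N : ℕ) : ℤ) - 1)
        (fun w : Site (d + 1) => (if w ν % ((Lc * N : ℕ) : ℤ) = ((Lc * N : ℕ) : ℤ) - 1 then (1 : ℝ) else 0)) (fun _ => z) (fun w => w) b ν,
      faceface_e3OfK_eq_stairN cΛt cΛ j hM hM ν ν z b, stairFace_diag_eq_zeroM (Lc := Lc) hM j ν z b, mul_zero, mul_zero]
  simp_rw [hR, mul_zero, Finset.sum_const_zero, tsum_zero, mul_zero]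

/-- NOT IN PRINT; OUR BOOKKEEPING.  **LEFT DIAGONAL, unit-scaled table**: the cell pairing is `0`. -/
theorem cellPairing_deep_eq_zero_of_left_diag_units (cΛt sf sm cE cΛ : ℝ) (j N : ℕ) [NeZero N] (μ ν β : Fin (d + 1)) :
    ∑ x ∈ box (d + 1) (Lc * N), ∑ a : Fin (d + 1),
        (∑' y : Site (d + 1), (if y μ % ((Lc * N : ℕ) : ℤ) = ((Lc * N : ℕ) : ℤ) - 1 then (1 : ℝ) else 0) *
          ∑' t : Site (d + 1), (if t μ % ((Lc * N : ℕ) : ℤ) = ((Lc * N : ℕ) : ℤ) - 1 then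
            unitS sf sm (fun κ u => cE • e3OfK Lc (coDressKBmAt (toSite (ctrOff (d + 1) Lc)) Lc (KInvStep (d := d) Lc j))
              (fun κ u => comp (comp (trK (psiKS (ctrOff (d + 1) Lc) Lc)) (slotPsiS (ctrOff (d + 1) Lc) Lc (ScombOf (symTablesAn1S2 d Lc cΛt) ((Lc : ℝ) ^ (d + 1)) (-((Lc : ℝ) ^ (d + 1) * (1 / 2) * (Lc : ℝ) ^ (d + 1))) cΛ j) κ u)) (psiKS (ctrOff (d + 1) Lc) Lc)) κ u) μ t y (toSite x) (Sum.inl μ) (Sum.inl a)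
            else 0)) *
        (∑' z : Site (d + 1), ∑ b : Fin (d + 1), unitK sf sm (coDressKBmAt (toSite (ctrOff (d + 1) Lc)) Lc (KInvStep (d := d) Lc (j + 1))) (toSite x) z (Sum.inl a) (Sum.inl b) *
          (∑' w : Site (d + 1), (if w β % ((Lc * N : ℕ) : ℤ) = ((Lc * N : ℕ) : ℤ) - 1 then (1 : ℝ) else 0) *
            ∑' t : Site (d + 1), (if t ν % ((Lc * N : ℕ) : ℤ) = ((Lc * N : ℕ) : ℤ) - 1 then
              unitS sf sm (fun κ u => cE • e3OfK Lc (coDressKBmAt (toSite (ctrOff (d + 1) Lc)) Lc (KInvStep (d := d) Lc j))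
                (fun κ u => comp (comp (trK (psiKS (ctrOff (d + 1) Lc) Lc)) (slotPsiS (ctrOff (d + 1) Lc) Lc (ScombOf (symTablesAn1S2 d Lc cΛt) ((Lc : ℝ) ^ (d + 1)) (-((Lc : ℝ) ^ (d + 1) * (1 / 2) * (Lc : ℝ) ^ (d + 1))) cΛ j) κ u)) (psiKS (ctrOff (d + 1) Lc) Lc)) κ u) ν t z w (Sum.inl b) (Sum.inl β)
              else 0))) = 0 := by
  have hM : 1 ≤ Lc * N := Nat.mul_pos (one_le_of_neZero Lc) (one_le_of_neZero N)
  refine Finset.sum_eq_zero fun x _ => Finset.sum_eq_zero fun a _ => ?_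
  rw [faceface_unitS_smul' sf sm cE _ μ (fun t : Site (d + 1) => t μ % ((Lc * N : ℕ) : ℤ) = ((Lc * N : ℕ) : ℤ) - 1)
      (fun y : Site (d + 1) => (if y μ % ((Lc * N : ℕ) : ℤ) = ((Lc * N : ℕ) : ℤ) - 1 then (1 : ℝ) else 0)) (fun y => y) (fun _ => toSite x) μ a,
    faceface_e3OfK_eq_stairN_fst cΛt cΛ j hM hM μ μ (toSite x) a, stairFace_diag_eq_zero_fstM (Lc := Lc) hM j μ (toSite x) a, mul_zero, mul_zero, zero_mul]


end Summit.QuantumFields.BalabanUV.Beta.GAN24.CombFaceWordEEValueDeep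

end
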